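import Literature.AlgebraicGeometry.Resolution.ArithmeticalThreefoldsLocalPermissible
import Literature.AlgebraicGeometry.Resolution.QuadraticTransforms
import Literature.AlgebraicGeometry.Resolution.RegularLocalRingsQuotient
import Literature.AlgebraicGeometry.Resolution.RegularLocalRingsProofs
import Literature.RingTheory.HilbertSamuel.NormalFlatnessHilbertFunction
import HarnessLib

/-!
# [OURS · L1 W4.2] THE ISO-KERNEL IN COSSART–PILTANT'S FRAME: no infinite point-blow-up tower along a valuation through
# HS-ISOLATED stages of a `p`-cyclic threefold hypersurface germ — MODULO the printed Cossart–Piltant 2019 Thm. 1.5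

Crux chain w42 (`SigmaMaxModifications`, stmt-ResolutionOfSingularities-18506; conjunct `SigmaMaxModificationsCorridor3`, stmt-…-19249),
line `w_ladder`, registered stubs `stub_isoInsepTower` / `stub_isoSepRecurrent` of skeleton v8.5 (the residual of the isolated kernel
`IsoQuadraticTowerTerminates p 3` = «no infinite tower of closed-point blow-ups at near points that are ISOLATED in the Hilbert–Samuel
stratum»). Lead res-L1-w42-lead-1 (gen 5). Helper file `--supports stmt-ResolutionOfSingularities-19249`; kernel only (no definition,
no new named fact; the printed theorem enters as the explicit hypothesis `(hCP : CossartPiltant2019LocalPermissible)` — CONDITIONAL on it).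

THE POINT. Cossart–Piltant's local theorem (J. Algebra 529 (2019) Thm. 1.5 = arXiv v1 Thm. 1.4; tree: NAMED FACT
`CossartPiltant2019LocalPermissible`, res-type-026, normally-flat rendering of Def. 2.7 (i)) says: for the `p`-cyclic hypersurface germ
`𝒳 = Spec R[x]` (`R` excellent regular local of dimension `3`, residue characteristic `p`, `h(x) = 0`, `h` monic of degree `p`, purely
inseparable or Galois case) and ANY valuation ring `O` dominating `R`, a finite tower of LOCAL HIRONAKA-PERMISSIBLE blowing ups along `O`
(centre `P` with regular quotient and `𝒳` normally flat along `P`) reaches a regular local ring. Bennett / CJS Thm. 3.3 (tree: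
`hilbertFun_eq_hilbertSamuelFun_of_isNormallyFlat`): along a normally flat regular centre the Hilbert–Samuel function is constant, so a
normally flat regular prime `P ≠ 𝔪` is a GENERIZATION of the closed point INSIDE its Hilbert–Samuel stratum. Hence, at a stage whose
closed point is ISOLATED in its Hilbert–Samuel stratum (even only among generizations: `H^{(dim A/Q)}(A_Q) ≠ H^{(0)}(A)` for every
prime `Q ≠ 𝔪` with regular quotient), the only Hironaka-permissible centre is the closed point, the permissible step IS the quadratic
transform along `O` (tree: `IsQuadraticTransformAlong`, unique by `IsQuadraticTransformAlong.unique`), and Cossart–Piltant's tower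
coincides with ANY prescribed tower of point blow-ups along `O` through HS-isolated stages — which therefore reaches a regular member:
it cannot keep a constant singular Hilbert–Samuel value for ever.

WHAT IS PROVED (ring-side, inside one field `L`, the frame of the named fact verbatim):
* `IsLocalRing.eq_maximalIdeal_of_isNormallyFlat_of_hilbert_ne` — the Bennett bridge: a normally flat prime with regular quotient at an
  HS-isolated (among generizations) Noetherian local ring is the maximal ideal;
* `exists_isRegularLocalRing_of_pointTower_of_CP` — in CP's frame, every tower `T : ℕ → Subring L` with `T 0` the local ring of `𝒳`
  at the centre of `O`, each `T (i+1)` the quadratic transform of `T i` along `O`, and every `T i` WITHOUT a proper normally-flat regular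
  prime, has a REGULAR member (modulo `CossartPiltant2019LocalPermissible`);
* `false_of_singular_pointTower_of_CP` — so no such tower is singular at every stage;
* `exists_isRegularLocalRing_of_hsIsolated_pointTower_of_CP` / `false_of_hsIsolated_singular_pointTower_of_CP` — the same with the
  hypothesis in Hilbert–Samuel currency (HS-isolated among generizations at every stage).
This is the isolated kernel's statement READ IN PRINT'S HARDEST SOLVED CASE — the wild heartland `z^p + f` (Moh / Hauser kangaroo /
Cossart–Piltant), every residue field (no perfectness), embedding dimension `4` — along the valuation through the tower; what it does NOT
give: origins of embedding dimension `≥ 5` / multiplicity `≠ p` (CP's Thm. 1.1 for general reduced threefolds is NOT by Hironaka-permissible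
blow-ups, CP p. 3), and the scheme ↔ ring dictionary from `IsIsoPointTower` (a Chevalley valuation through the marked points, stalks as
subrings of the function field) is left to the consumer.

HONEST FRAMING. OURS bookkeeping over a PRINTED theorem taken as a hypothesis; nothing here is a statement of H. Hironaka's manuscript
[Hironaka2017] nor a new claim about [CossartPiltant2019] (the reduction «isolated stage ⇒ the permissible centre is the point» is the
paragraph «Print placement» of `CossartPiltantHironakaLocalUniformizationBranch.lean`, here with isolated SINGULARITY weakened to
HS-isolation through Bennett). Pattern of proof adapted from res-type-026's `hironakaLUIsolatedBranch_of_localPermissibleSing` (W4.1).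
AI-written; AI review is weaker than expert review.

References: V. Cossart, O. Piltant, *Resolution of singularities of arithmetical threefolds*, J. Algebra 529 (2019), Thm. 1.5 (arXiv v1
Thm. 1.4), Def. 2.20–2.21 (v1 Def. 2.7), p. 3 [CossartPiltant2019]; V. Cossart, U. Jannsen, S. Saito, LNM 2270 (2020), Thm. 3.3
[CossartJannsenSaito2020]; B. M. Bennett, Ann. of Math. 91 (1970), Thm. (3) [Bennett1970]; S. D. Cutkosky (2014) §2.2 (quadratic transforms
along a valuation) [Cutkosky2014]; J. Novacoski, M. Spivakovsky, Def. 2.11 [NovacoskiSpivakovsky2014].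
-/

noncomputable section

set_option linter.dupNamespace false

open Polynomial IsLocalRing
open Literature.AlgebraicGeometry.Resolution Literature.RingTheory.HilbertSamuel

namespace Summit.ResolutionOfSingularities.ResolutionOfSingularities.Cruxes.SigmaMaxModifications.IdeasL1C5

universe u

/-! ## §1. The Bennett bridge: at an HS-isolated local ring the only normally flat regular prime is the maximal ideal -/

/-- **Bennett bridge.** In a Noetherian local ring `A`, a prime `P` with `A ⧸ P` regular along which `A` is normally flat has
`H^{(0)}(A) = H^{(dim A/P)}(A_P)` (CJS Thm. 3.3 (1) ⇒ (2), tree `hilbertFun_eq_hilbertSamuelFun_of_isNormallyFlat`); so if the closed point is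
HS-ISOLATED AMONG GENERIZATIONS — `H^{(dim A/Q)}(A_Q) ≠ H^{(0)}(A)` for every prime `Q ≠ 𝔪` with regular quotient — then `P = 𝔪`.
[cite: CossartJannsenSaito2020, Thm. 3.3] [cite: Bennett1970, Thm. (3)] -/
theorem _root_.IsLocalRing.eq_maximalIdeal_of_isNormallyFlat_of_hilbert_ne {A : Type u} [CommRing A] [IsLocalRing A]
    [IsNoetherianRing A] (P : Ideal A) [P.IsPrime] [IsRegularLocalRing (A ⧸ P)] (hNF : P.IsNormallyFlat)
    (hiso : ∀ Q : Ideal A, ∀ _ : Q.IsPrime, Q ≠ maximalIdeal A → IsRegularLocalRing (A ⧸ Q) →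
      ∀ r : ℕ, ringKrullDim (A ⧸ Q) = r → hilbertSamuelFun (Localization.AtPrime Q) r ≠ hilbertFun A) :
    P = maximalIdeal A := by
  by_contra hne
  obtain ⟨r, hr⟩ := exists_nat_cast_eq_ringKrullDim (R := A ⧸ P)
  exact hiso P inferInstance hne inferInstance r hr
    (hilbertFun_eq_hilbertSamuelFun_of_isNormallyFlat P (Localization.AtPrime P) hr hNF).symm

/-! ## §2. Cossart–Piltant's permissible tower coincides with any point tower through stages without proper permissible centres -/

section CPFrame

variable {L : Type u} [Field L]

/-- In a local subring of `L`, a MAXIMAL normally-flat-regular prime is the maximal ideal, so a local Hironaka-permissible blowing up along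
it is THE quadratic transform along `O`. [cite: Cutkosky2014, §2.2] [cite: NovacoskiSpivakovsky2014, Def. 2.11] -/
theorem isQuadraticTransformAlong_of_isLocalBlowupAlong_of_isMaximal {O : ValuationSubring L} {C C' : Subring L} [IsLocalRing C]
    {P : Ideal C} (hP : P.IsMaximal) (hblow : IsLocalBlowupAlong O C P C') : IsQuadraticTransformAlong O C C' := by
  have hPm : P = maximalIdeal C := (IsLocalRing.eq_maximalIdeal hP)
  subst hPm
  exact ⟨inferInstance, hblow⟩

/-- **THE PERMISSIBLE TOWER OF COSSART–PILTANT'S THM. 1.5 IS ANY PRESCRIBED POINT TOWER THROUGH STAGES WITHOUT PROPER PERMISSIBLE CENTRES —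
hence such a tower has a REGULAR member.** Frame of the named fact verbatim (`p`-cyclic hypersurface germ `R[x] ⊂ L` over an excellent regular
local `R` of dimension `3` and residue characteristic `p`; (MIN), (GEN); case (i) purely inseparable or (ii) Galois; `O` a valuation ring of `L`
dominating `R`). The tower `T`: `T 0` is the local ring of the germ at the centre of `O`, every `T (i+1)` is the quadratic transform of `T i`
along `O` (the local blowing up of the closed point), and at every stage every prime `P` with regular quotient along which `T i` is normally
flat is MAXIMAL (no proper Hironaka-permissible centre — e.g. the closed point is HS-isolated, §1). CONDITIONAL on `CossartPiltant2019LocalPermissible`.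
[cite: CossartPiltant2019, Thm. 1.5 (arXiv v1: Thm. 1.4), Def. 2.20–2.21] [cite: Cutkosky2014, §2.2] -/
theorem exists_isRegularLocalRing_of_pointTower_of_CP (hCP : CossartPiltant2019LocalPermissible.{u})
    (p : ℕ) (hp : p.Prime) (R : Subring L) [IsRegularLocalRing R]
    (hexc : IsExcellentRing R) (hdim : ringKrullDim R = 3) (hchar : CharP (ResidueField R) p)
    (h : R[X]) (x : L) (hmon : h.Monic) (hdeg : h.natDegree = p) (hx : aeval x h = 0)
    (hmin : ∀ g : R[X], g.natDegree < p → aeval x g = 0 → g = 0)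
    (hgen : ∀ z : L, ∃ (g : R[X]) (s : R), s ≠ 0 ∧ z * s = aeval x g)
    (hcase : (CharP L p ∧ ∀ i, 0 < i → i < p → h.coeff i = 0) ∨
      (Nat.card (L ≃ₐ[R] L) = p ∧
        ∀ σ : L ≃ₐ[R] L, ∀ y ∈ Algebra.adjoin R ({x} : Set L), σ y ∈ Algebra.adjoin R ({x} : Set L)))
    (O : ValuationSubring L) (hRO : R ≤ O.toSubring) (hdom : ∀ r : R, r ∈ maximalIdeal R → O.valuation (r : L) < 1)
    (T : ℕ → Subring L) (hT0 : T 0 = locAtCentre (Algebra.adjoin R ({x} : Set L)).toSubring O)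
    (hstep : ∀ i, IsQuadraticTransformAlong O (T i) (T (i + 1)))
    (hnpc : ∀ (i : ℕ) (C : Subring L), C = T i → ∀ P : Ideal C, IsRegularLocalRing (C ⧸ P) → P.IsNormallyFlat → P.IsMaximal) :
    ∃ r, IsRegularLocalRing (T r) := by
  obtain ⟨r, B, hB0, hB, hreg⟩ := hCP p hp L R hexc hdim hchar h x hmon hdeg hx hmin hgen hcase O hRO hdom
  -- the fact's tower IS the prescribed tower, stage by stage
  have key : ∀ n ≤ r, B n = T n := fun n hn => by
    induction n with
    | zero => rw [hB0, hT0]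
    | succ n ih =>
      have hBn := ih (Nat.le_of_succ_le hn)
      obtain ⟨P, hPreg, hPnf, hblow⟩ := hB n (Nat.lt_of_succ_le hn)
      have aux : ∀ C : Subring L, C = T n → ∀ P : Ideal C, IsRegularLocalRing (C ⧸ P) → P.IsNormallyFlat →
          IsLocalBlowupAlong O C P (B (n + 1)) → B (n + 1) = T (n + 1) := by
        intro C hC P hPreg hPnf hblow
        have hmax : P.IsMaximal := hnpc n C hC P hPreg hPnf
        subst hC
        obtain ⟨hloc, _⟩ := hstep n
        exact (isQuadraticTransformAlong_of_isLocalBlowupAlong_of_isMaximal hmax hblow).unique (hstep n)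
      exact aux (B n) hBn P hPreg hPnf hblow
  exact ⟨r, by rw [← key r le_rfl]; exact hreg⟩

/-- **… so NO SUCH TOWER IS SINGULAR AT EVERY STAGE** (a constant singular Hilbert–Samuel value cannot persist along point blow-ups at stages
without proper permissible centres, in Cossart–Piltant's frame). CONDITIONAL on `CossartPiltant2019LocalPermissible`.
[cite: CossartPiltant2019, Thm. 1.5 (arXiv v1: Thm. 1.4)] -/
theorem false_of_singular_pointTower_of_CP (hCP : CossartPiltant2019LocalPermissible.{u})
    (p : ℕ) (hp : p.Prime) (R : Subring L) [IsRegularLocalRing R]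
    (hexc : IsExcellentRing R) (hdim : ringKrullDim R = 3) (hchar : CharP (ResidueField R) p)
    (h : R[X]) (x : L) (hmon : h.Monic) (hdeg : h.natDegree = p) (hx : aeval x h = 0)
    (hmin : ∀ g : R[X], g.natDegree < p → aeval x g = 0 → g = 0)
    (hgen : ∀ z : L, ∃ (g : R[X]) (s : R), s ≠ 0 ∧ z * s = aeval x g)
    (hcase : (CharP L p ∧ ∀ i, 0 < i → i < p → h.coeff i = 0) ∨
      (Nat.card (L ≃ₐ[R] L) = p ∧
        ∀ σ : L ≃ₐ[R] L, ∀ y ∈ Algebra.adjoin R ({x} : Set L), σ y ∈ Algebra.adjoin R ({x} : Set L)))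
    (O : ValuationSubring L) (hRO : R ≤ O.toSubring) (hdom : ∀ r : R, r ∈ maximalIdeal R → O.valuation (r : L) < 1)
    (T : ℕ → Subring L) (hT0 : T 0 = locAtCentre (Algebra.adjoin R ({x} : Set L)).toSubring O)
    (hstep : ∀ i, IsQuadraticTransformAlong O (T i) (T (i + 1)))
    (hnpc : ∀ (i : ℕ) (C : Subring L), C = T i → ∀ P : Ideal C, IsRegularLocalRing (C ⧸ P) → P.IsNormallyFlat → P.IsMaximal)
    (hsing : ∀ i, ¬ IsRegularLocalRing (T i)) : False := by
  obtain ⟨r, hr⟩ := exists_isRegularLocalRing_of_pointTower_of_CP hCP p hp R hexc hdim hchar h x hmon hdeg hx hmin hgen hcase O hRO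
    hdom T hT0 hstep hnpc
  exact hsing r hr

/-! ## §3. The same in Hilbert–Samuel currency: HS-isolated stages -/

/-- **POINT TOWERS THROUGH HS-ISOLATED STAGES REACH A REGULAR MEMBER** (Cossart–Piltant's frame): as `exists_isRegularLocalRing_of_pointTower_of_CP`,
with «no proper permissible centre» replaced by «the closed point of every stage is HS-isolated among generizations» — for every stage
`T i` (a Noetherian local ring) and every prime `Q ≠ 𝔪` with regular quotient, `H^{(dim T i/Q)}((T i)_Q) ≠ H^{(0)}(T i)` — through the
Bennett bridge of §1. CONDITIONAL on `CossartPiltant2019LocalPermissible`.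
[cite: CossartPiltant2019, Thm. 1.5 (arXiv v1: Thm. 1.4)] [cite: CossartJannsenSaito2020, Thm. 3.3] -/
theorem exists_isRegularLocalRing_of_hsIsolated_pointTower_of_CP (hCP : CossartPiltant2019LocalPermissible.{u})
    (p : ℕ) (hp : p.Prime) (R : Subring L) [IsRegularLocalRing R]
    (hexc : IsExcellentRing R) (hdim : ringKrullDim R = 3) (hchar : CharP (ResidueField R) p)
    (h : R[X]) (x : L) (hmon : h.Monic) (hdeg : h.natDegree = p) (hx : aeval x h = 0)
    (hmin : ∀ g : R[X], g.natDegree < p → aeval x g = 0 → g = 0)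
    (hgen : ∀ z : L, ∃ (g : R[X]) (s : R), s ≠ 0 ∧ z * s = aeval x g)
    (hcase : (CharP L p ∧ ∀ i, 0 < i → i < p → h.coeff i = 0) ∨
      (Nat.card (L ≃ₐ[R] L) = p ∧
        ∀ σ : L ≃ₐ[R] L, ∀ y ∈ Algebra.adjoin R ({x} : Set L), σ y ∈ Algebra.adjoin R ({x} : Set L)))
    (O : ValuationSubring L) (hRO : R ≤ O.toSubring) (hdom : ∀ r : R, r ∈ maximalIdeal R → O.valuation (r : L) < 1)
    (T : ℕ → Subring L) (hT0 : T 0 = locAtCentre (Algebra.adjoin R ({x} : Set L)).toSubring O)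
    (hstep : ∀ i, IsQuadraticTransformAlong O (T i) (T (i + 1)))
    (hnoeth : ∀ i, IsNoetherianRing (T i))
    (hiso : ∀ (i : ℕ) (C : Subring L), C = T i → ∀ (_ : IsLocalRing C) (Q : Ideal C) (_ : Q.IsPrime), Q ≠ maximalIdeal C →
      IsRegularLocalRing (C ⧸ Q) → ∀ r : ℕ, ringKrullDim (C ⧸ Q) = r → hilbertSamuelFun (Localization.AtPrime Q) r ≠ hilbertFun C) :
    ∃ r, IsRegularLocalRing (T r) := by
  refine exists_isRegularLocalRing_of_pointTower_of_CP hCP p hp R hexc hdim hchar h x hmon hdeg hx hmin hgen hcase O hRO hdom T hT0 hstep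
    fun i C hC P hPreg hPnf => ?_
  subst hC
  obtain ⟨hloc, _⟩ := hstep i
  haveI := hnoeth i
  haveI : IsDomain ((T i) ⧸ P) := isDomain_of_isRegularLocalRing _
  haveI : P.IsPrime := (Ideal.Quotient.isDomain_iff_prime P).mp inferInstance
  rw [IsLocalRing.eq_maximalIdeal_of_isNormallyFlat_of_hilbert_ne P hPnf (hiso i (T i) rfl hloc)]
  exact IsLocalRing.maximalIdeal.isMaximal _

/-- **THE ISO-KERNEL IN COSSART–PILTANT'S FRAME**: no point-blow-up tower along a valuation through HS-isolated, SINGULAR stages of a `p`-cyclic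
threefold hypersurface germ is infinite — i.e. the isolated kernel's conclusion holds, in print's hardest solved case, along the valuation
through the tower. CONDITIONAL on `CossartPiltant2019LocalPermissible` (a printed theorem). [cite: CossartPiltant2019, Thm. 1.5 (arXiv v1: Thm. 1.4)]
[cite: CossartJannsenSaito2020, Thm. 3.3, Def. 6.38] -/
theorem false_of_hsIsolated_singular_pointTower_of_CP (hCP : CossartPiltant2019LocalPermissible.{u})
    (p : ℕ) (hp : p.Prime) (R : Subring L) [IsRegularLocalRing R]
    (hexc : IsExcellentRing R) (hdim : ringKrullDim R = 3) (hchar : CharP (ResidueField R) p)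
    (h : R[X]) (x : L) (hmon : h.Monic) (hdeg : h.natDegree = p) (hx : aeval x h = 0)
    (hmin : ∀ g : R[X], g.natDegree < p → aeval x g = 0 → g = 0)
    (hgen : ∀ z : L, ∃ (g : R[X]) (s : R), s ≠ 0 ∧ z * s = aeval x g)
    (hcase : (CharP L p ∧ ∀ i, 0 < i → i < p → h.coeff i = 0) ∨
      (Nat.card (L ≃ₐ[R] L) = p ∧
        ∀ σ : L ≃ₐ[R] L, ∀ y ∈ Algebra.adjoin R ({x} : Set L), σ y ∈ Algebra.adjoin R ({x} : Set L)))
    (O : ValuationSubring L) (hRO : R ≤ O.toSubring) (hdom : ∀ r : R, r ∈ maximalIdeal R → O.valuation (r : L) < 1)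
    (T : ℕ → Subring L) (hT0 : T 0 = locAtCentre (Algebra.adjoin R ({x} : Set L)).toSubring O)
    (hstep : ∀ i, IsQuadraticTransformAlong O (T i) (T (i + 1)))
    (hnoeth : ∀ i, IsNoetherianRing (T i))
    (hiso : ∀ (i : ℕ) (C : Subring L), C = T i → ∀ (_ : IsLocalRing C) (Q : Ideal C) (_ : Q.IsPrime), Q ≠ maximalIdeal C →
      IsRegularLocalRing (C ⧸ Q) → ∀ r : ℕ, ringKrullDim (C ⧸ Q) = r → hilbertSamuelFun (Localization.AtPrime Q) r ≠ hilbertFun C)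
    (hsing : ∀ i, ¬ IsRegularLocalRing (T i)) : False := by
  obtain ⟨r, hr⟩ := exists_isRegularLocalRing_of_hsIsolated_pointTower_of_CP hCP p hp R hexc hdim hchar h x hmon hdeg hx hmin hgen hcase O
    hRO hdom T hT0 hstep hnoeth hiso
  exact hsing r hr

end CPFrame

end Summit.ResolutionOfSingularities.ResolutionOfSingularities.Cruxes.SigmaMaxModifications.IdeasL1C5

end
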